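/-
Origin: expansion seat `planner-pub-hodgecm-toy-g3-0`, handover #6 2026-08-18T12:10:34Z (`HOME/pub-hodgecm-toy-g3/lean/ToyG3/TrTop3.lean`, md5 886f0851, 154 lines);
landed by the gen-8 packager in gate run 29 as `HodgeCM/Model/ToyG2/TrTop3.lean` (import ^import ToyG3\.DescentFacts3[ \t]*$→import HodgeCM.Model.ToyG2.DescentFacts3 ×1).
-/
/-
Copyright: pub-hodgecm formalisation cell (harness21, 2026). New file (not vendored).
Origin: session planner-pub-hodgecm-toy-g3-0 (unit pub-hodgecm-toy-g3, EXPANSION part (e) CONSISTENCY WITNESS, gen 3 of the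
lineage toy → toy-g2 → toy-g3), 2026-08-18.  WIP module `ToyG3.TrTop3`; intended final place
`HodgeCM/Model/ToyG2/TrTop3.lean` (module `HodgeCM.Model.ToyG2.TrTop3`; kind L5, toy model / consistency witness —
ONE NEW ADDITIVE FILE, no landed file is touched).  Its one WIP import `ToyG3.DescentFacts3` ↦ `HodgeCM.Model.ToyG2.DescentFacts3`;
the other imports are FINAL package names (in the tree since gate run 27).
-/
import Mathlib
import Summits.HodgeConjecture.HodgeCM.Model.ToyG2.DescentFacts3_2
import Summits.HodgeConjecture.HodgeCM.Model.ToyG2.RadicalFree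
import Summits.HodgeConjecture.HodgeCM.StubTree.Qw8Monomial_3

/-!
# T-CM `Fact_trTopCM` HOLDS in the generation-2 toy universe (Künneth traces)

`Universe.Fact_trTopCM` (`StubTree/Qw8Monomial.lean`; the binder `ht` of `Assembly.COR_CM_of_genericFacts`): on every CM
product `A′ = ∏_{j ≤ n} A_{(F,Θ_j)}` the top-degree trace `∫ : H^{2 dim A′}(A′, ℚ) → ℚ` is injective.  FACTS.md §1c records
it (with the `∀ X` form T `Fact_trTop`) as "REFUTED in the exterior model and in EVERY re-trace" — generation 1 has `tr := 0`
(`HodgeCM.Toy.not_fact_trTopCM`, `Model/Toy/ToyTrTop.lean`), and in every re-tracing of generation 1 M26 forces the trace of a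
CM surface to vanish (`HodgeCM.Toy.Retrace.not_trTopCM_of_gysin_surface`); that file concludes "a model of
`ModelAxioms ∧ Fact_trTopCM` needs padded objects with honest top cohomology — a new model, not merely a new trace".

toy-g2's generation-2 universe `toyModel3With D traceSys pl` (good objects, KÜNNETH trace system `traceSys`, `tr := trOf`,
`Model/ToyG2/Trace.lean`) is such a model, and this file records the (short) verification:

* `trOf_sdeg_ne_zero` (toy-g2, `Model/ToyG2/RadicalFree.lean`): the trace of a GOOD object in degree `sdeg = 2 dim`
  (`sdeg_eq`) is a nonzero functional — every variety of `toyModel3With` is good (`GObj.good`);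
* `finrank_L_cmProd₃`: `dim_ℚ H¹(A′) = 2 dim A′` for CM products, from the universe-generic `Universe.finrank_coh_one_cmProd`
  (M21/M22) and `Universe.two_mul_dim_cmProd_of_dimProd` (M40 `Fact_dimProd`, witnessed by `fact3_dimProd`), given the model
  axioms `M`; hence `H^{2 dim A′}(A′) = ⋀^{2 dim A′} H¹` is ONE-dimensional (`finrank_coh_top_cmProd₃`, Mathlib's
  `exteriorPower.finrank_eq`);
* a nonzero linear functional on a one-dimensional space is injective (`injective_of_ne_zero_of_finrank_eq_one`).

Hence `fact3_trTopCM D pl M : (toyModel3With D traceSys pl).Fact_trTopCM` for EVERY Hodge datum `D` and block assignment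
`pl`, and in particular `toyUniverse₃_trTopCM d t M` for `toyUniverse₃ d t = toyModel3With exteriorHodgeData traceSys (gplOf d t)`
— jointly with everything `DescentFacts3` / `OpenInputs3` establish there (`toyUniverse₃_descentFactsB₄_and_trTopCM`).
So T-CM is CONSISTENT with `ModelAxioms`, the face realisation, N1–N4, F4, F5, F-H0, F7d, F7d-B and `Fact_dimProd`; of the
eleven binders of `Assembly.COR_CM_of_genericFacts` only F7 `Fact_gysin` (Gysin maps of block projections with the projection
formula) is not witnessed here.

NOT CLAIMED: the `∀ X` form T `Fact_trTop` (bijectivity on EVERY variety).  It is not to be expected in this universe: the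
period leaf `P(L, ι₁)` has `dim = 2`, but its lattice is the direct sum of the lattices of its theta blocks, each of rank
`4·[L:ℚ] ≥ 8`, so its `H⁴ = ⋀⁴` has dimension `≥ 70` as soon as there is one block and a nonzero functional on it is not
injective; no statement about T is made here in either direction.  Nothing is said about complex projective varieties; everything is kernel-proved from the tree, no
citation, nothing posited.  Heartbeats: default throughout.
-/

noncomputable section

open scoped TensorProduct
open exteriorPower Module
open Literature.AlgebraicGeometry.Motives

namespace HodgeCM.ToyG2

open HodgeCM.Toy

/-! ### Linear algebra: a nonzero functional on a line is injective -/

/-- A nonzero `ℚ`-linear functional on a one-dimensional `ℚ`-space is injective. -/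
theorem injective_of_ne_zero_of_finrank_eq_one {V : Type*} [AddCommGroup V] [Module ℚ V] (f : V →ₗ[ℚ] ℚ)
    (hf : f ≠ 0) (h1 : Module.finrank ℚ V = 1) : Function.Injective f := by
  haveI : Module.Finite ℚ V := Module.finite_of_finrank_eq_succ h1
  rw [LinearMap.injective_iff_surjective_of_finrank_eq_finrank (by rw [h1, Module.finrank_self])]
  obtain ⟨v, hv⟩ : ∃ v, f v ≠ 0 := by
    by_contra h
    push Not at h
    exact hf (LinearMap.ext h)
  intro q
  exact ⟨(q / f v) • v, by rw [map_smul, smul_eq_mul, div_mul_cancel₀ q hv]⟩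

variable (D : HodgeData) (T : TraceSys) (pl : GBlocks)

/-! ### Rank bookkeeping on CM products (any Hodge datum, any trace system) -/

/-- `dim_ℚ H¹(A′) = 2 dim A′` for the CM product `A′ = ∏_{j ≤ m} A_{(F,Θ'_j)}` of `toyModel3With D T pl` (M21/M22 via
`Universe.finrank_coh_one_cmProd`, M40 via `Universe.two_mul_dim_cmProd_of_dimProd` and `fact3_dimProd`). -/
theorem finrank_L_cmProd₃ (M : (toyModel3With D T pl).ModelAxioms) (F : CMField) {m : ℕ} (Θ' : Fin (m + 1) → CMType F) :
    Module.finrank ℚ ((toyModel3With D T pl).cmProd F Θ').X.L = 2 * ((toyModel3With D T pl).cmProd F Θ').X.dim := by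
  have h1 := Universe.finrank_coh_one_cmProd M F Θ'
  change Module.finrank ℚ ↥(⋀[ℚ]^1 ((toyModel3With D T pl).cmProd F Θ').X.L) = _ at h1
  haveI : Module.Free ℚ ((toyModel3With D T pl).cmProd F Θ').X.L := Module.Free.of_divisionRing ℚ _
  rw [exteriorPower.finrank_eq, Nat.choose_one_right] at h1
  have h2 := Universe.two_mul_dim_cmProd_of_dimProd M (fact3_dimProd D T pl) F Θ'
  rw [h1, ← h2]

/-- `dim_ℚ H^{2 dim A′}(A′) = 1`: the top exterior power of `H¹(A′)`. -/
theorem finrank_coh_top_cmProd₃ (M : (toyModel3With D T pl).ModelAxioms) (F : CMField) {m : ℕ}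
    (Θ' : Fin (m + 1) → CMType F) :
    Module.finrank ℚ ((toyModel3With D T pl).Coh ((toyModel3With D T pl).cmProd F Θ')
      (2 * (toyModel3With D T pl).dim ((toyModel3With D T pl).cmProd F Θ'))) = 1 := by
  change Module.finrank ℚ ↥(⋀[ℚ]^(2 * ((toyModel3With D T pl).cmProd F Θ').X.dim)
    ((toyModel3With D T pl).cmProd F Θ').X.L) = 1
  haveI : Module.Free ℚ ((toyModel3With D T pl).cmProd F Θ').X.L := Module.Free.of_divisionRing ℚ _
  rw [exteriorPower.finrank_eq, finrank_L_cmProd₃ D T pl M F Θ', Nat.choose_self]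

/-! ### T-CM in the Künneth-traced universe -/

/-- **T-CM `Fact_trTopCM` holds in `toyModel3With D traceSys pl`** (given its model axioms): the Künneth trace of the good
object `A′` in degree `2 dim A′ = sdeg A′` is a nonzero functional (`trOf_sdeg_ne_zero`) on the line `H^{2 dim A′}(A′)`. -/
theorem fact3_trTopCM (M : (toyModel3With D traceSys pl).ModelAxioms) : (toyModel3With D traceSys pl).Fact_trTopCM := by
  intro F n Θ
  change Function.Injective (trOf ((toyModel3With D traceSys pl).cmProd F Θ).X
    (2 * ((toyModel3With D traceSys pl).cmProd F Θ).X.dim))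
  apply injective_of_ne_zero_of_finrank_eq_one
  · have h := trOf_sdeg_ne_zero ((toyModel3With D traceSys pl).cmProd F Θ).good
    rwa [sdeg_eq] at h
  · exact finrank_coh_top_cmProd₃ D traceSys pl M F Θ

/-! ### In `toyUniverse₃ d t` -/

section ToyUniverse

variable (d t : ℚ)

/-- **T-CM in `toyUniverse₃ d t`** (given its model axioms). -/
theorem toyUniverse₃_trTopCM (M : (toyUniverse₃ d t).ModelAxioms) : (toyUniverse₃ d t).Fact_trTopCM :=
  fact3_trTopCM exteriorHodgeData (gplOf d t) M

/-- **The ten binders of `Assembly.COR_CM_of_descentFactsB₄` AND T-CM, jointly, in `toyUniverse₃ d t`** (`1 ≤ d`, `t² = 16`,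
given the model axioms): `ModelAxioms ∧ RealisationExistsFace ∧ N1 ∧ N2 ∧ F4 ∧ F5 ∧ F-H0 ∧ F7d-B ∧ Fact_dimProd ∧ Fact_trTopCM`. -/
theorem toyUniverse₃_descentFactsB₄_and_trTopCM (hd : 1 ≤ d) (ht : t ^ 2 = 16) (M : (toyUniverse₃ d t).ModelAxioms) :
    ((toyUniverse₃ d t).ModelAxioms ∧ (toyUniverse₃ d t).RealisationExistsFace ∧ (toyUniverse₃ d t).Fact_cupExterior ∧
      (toyUniverse₃ d t).Fact_cup_hodge ∧ (toyUniverse₃ d t).Fact_cupAlg ∧ (toyUniverse₃ d t).Fact_cupAssoc ∧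
      (toyUniverse₃ d t).Fact_unitH0 ∧ (toyUniverse₃ d t).Fact_gysinDescentB ∧ (toyUniverse₃ d t).Fact_dimProd) ∧
    (toyUniverse₃ d t).Fact_trTopCM :=
  ⟨toyUniverse₃_descentFactsB₄ d t hd ht M, toyUniverse₃_trTopCM d t M⟩

/-- **Ten of the eleven binders of `Assembly.COR_CM_of_genericFacts` jointly** in `toyUniverse₃ d t` (`1 ≤ d`, `t² = 16`, given
the model axioms) — all but F7 `Fact_gysin`: `ModelAxioms ∧ RealisationExistsFace ∧ N1 ∧ N2 ∧ N3 ∧ N4 ∧ F4 ∧ F5 ∧ Fact_dimProd ∧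
Fact_trTopCM`. -/
theorem toyUniverse₃_genericFacts_but_gysin (hd : 1 ≤ d) (ht : t ^ 2 = 16) (M : (toyUniverse₃ d t).ModelAxioms) :
    (toyUniverse₃ d t).ModelAxioms ∧ (toyUniverse₃ d t).RealisationExistsFace ∧ (toyUniverse₃ d t).Fact_cupExterior ∧
      (toyUniverse₃ d t).Fact_cup_hodge ∧ (toyUniverse₃ d t).Fact_pull_H0 ∧ (toyUniverse₃ d t).Fact_hodge_F0 ∧
      (toyUniverse₃ d t).Fact_cupAlg ∧ (toyUniverse₃ d t).Fact_cupAssoc ∧ (toyUniverse₃ d t).Fact_dimProd ∧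
      (toyUniverse₃ d t).Fact_trTopCM :=
  ⟨M, ThetaUiso.realisationExistsFace₃ d t hd ht, fact3_cupExterior exteriorHodgeData traceSys (gplOf d t),
    fact3_cup_hodge traceSys (gplOf d t), fact3_pull_H0 exteriorHodgeData traceSys (gplOf d t),
    fact3_hodge_F0 traceSys (gplOf d t), fact3_cupAlg traceSys (gplOf d t), fact3_cupAssoc exteriorHodgeData traceSys (gplOf d t),
    fact3_dimProd exteriorHodgeData traceSys (gplOf d t), toyUniverse₃_trTopCM d t M⟩

/-- **Existence form** (given M26 `Fact_gysin_surface` for `toyUniverse₃ 1 4`, which yields its model axioms —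
`toyUniverse₃_modelAxioms_of_gysin`; the unconditional form is in `TrTopAll3` on top of pv03-g6's `SplitAllGood`):
some universe satisfies the ten binders of `COR_CM_of_descentFactsB₄` together with T-CM. -/
theorem exists_descentFactsB₄_inputs_and_trTopCM_of_gysin (h26 : (toyUniverse₃ 1 4).Fact_gysin_surface) :
    ∃ U : Universe, (U.ModelAxioms ∧ U.RealisationExistsFace ∧ U.Fact_cupExterior ∧ U.Fact_cup_hodge ∧ U.Fact_cupAlg ∧
      U.Fact_cupAssoc ∧ U.Fact_unitH0 ∧ U.Fact_gysinDescentB ∧ U.Fact_dimProd) ∧ U.Fact_trTopCM :=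
  ⟨toyUniverse₃ 1 4, toyUniverse₃_descentFactsB₄_and_trTopCM 1 4 le_rfl (by norm_num)
    (toyUniverse₃_modelAxioms_of_gysin 1 4 h26)⟩

end ToyUniverse

end HodgeCM.ToyG2
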